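import Summits.BirchSwinnertonDyer.BirchSwinnertonDyer.Theorems.SignedLowerHalvesKobayashiMainConjectureSmallImageLambdaTransferQ3RecordsL
import HarnessLib

/-!
# Route `SignedLowerHalves`, crux `KobayashiMainConjectureSmallImage` (item stmt-BirchSwinnertonDyer-19002):
# small-image congruence road («L4-λ») — RECORDS «L4LAM-r3» part L, ODD layer: the second sign `ε = −1` for `204624dp1 @ 5`
# (cell `bsd-ssimc`, seat `bsd-ssimc-k3-c4` gen 13, object «L4LAM-r3-L3»; a `--supports stmt-BirchSwinnertonDyer-19002 --as helper` file;
# closes nothing about the crux)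

PARTITION (cell bsd-ssimc): X7 (A7) × `204624dp1 @ 5` — per-pair record (Kobayashi's signed main conjecture for the SECOND sign `ε = −1`,
from PUBLISHED facts + displayed certificates; the pair's `∃ ε` record and its `BSDp W 5` door are part L, p528731, imported); the crux
`KobayashiMainConjectureSmallImage` stays OPEN; 0 census moves; nothing booked; BSD is not proved by any of this. THEOREMS ONLY.

## Provenance («L4LAM-r3-L3», k3c4-MEMO-12)

Part L (gen 12, k3c4-MEMO-11 §3 row L) recorded `ε = 1` only: the pair's first ODD layer is degenerate — `θ₁(E)` has `(μ, λ) = (1, 0)`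
(engine B of record, kit j275540: `θ₁(E)(0) = −40`, `θ₀(E)(0) = −20`, `[0]⁺ = 10 = ∏c_ℓ`; engine T undetermined, `V = 4 = φ(5)`) and `θ₁(A) ≡ 0` for the CM partner
`A = cm0p343` (`r_an(A) = 1`) — so the odd-sign invariant `l` (B. D. Kim / Pollack: `λ(θ_n) = deg ω_n^+ + l` for odd `n ≫ 0`) is invisible
below Pollack's `θ₃` (`deg ω₃⁺ = φ(25) = 20`, readable range `l < φ(125) − 20`). This file displays the `θ₃` rows instead: E `(μ, λ)(θ₃) =
(0, 20 + 6)`, A `(μ, λ)(θ₃) = (0, 20 + 5)`; the δ-bookkeeping of part L (`places_204624dp1_5`, kernel: `Σδ_E = 0`, `Σδ_A = 1` over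
`Σ₀ = {2, 3, 7, 29}`) closes `6 + 0 = 5 + 1`, and `l′ = 5` is `λ⁻(A)` of PARI's `ellpadiclambdamu(A, 5) = [[1, 5], [0, 0]]` (engine A of record).
Rows: kit j279021 (job of record) + j279184 (its eclib arm, re-launched once) — both `--workitem …19002`, evidence #43 / #44 on the item.
Engine B = the cell's msengine lit-g7 + `iwlayer.py` d2ade7e3 + `runB.py` b921e851 BYTE-IDENTICAL to j275540, run at `JOB_NPOL = 5:4`: E rows
`(μ, λ; θ_n(0))` at Pollack's `θ₀, θ₁, θ₂, θ₃` = `(1, 0; −20), (1, 0; −40), (0, 6; 100), (0, 26; 200)` (x₀ = `[0]⁺` = 10), A rows `θ₂, θ₃` = `(0, 5), (0, 25)`; cross-checked by EXACT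
modular symbols fed through the SAME `iwlayer.theta_data`: engine E = eclib (Sage 10.9, `modular_symbol(sign = +1, implementation = 'eclib')`,
j279184; the level-204624 space in 302 s) reproduces EVERY E row and A row above IDENTICALLY (including x₀ = 10 and the θ_n(0)); engine X = PARI
2.17 `msfromell`/`mseval` (j279021) reproduces the A rows identically and `ellpadiclambdamu(A, 5) = [[1, 5], [0, 0]]`. So the E-side `θ₃` row is
TWO-engine (B + eclib exact) and the partner's THREE-engine; engine T (twisted L-values) is infeasible at `θ₃` (conductor N·5⁸). Everything
else — road, binders (the L4LAM-r2 tuple EXACTLY: `h12 h41 h5 h3 h09 hKim hPR hmod hF′`, `hPollack`), partner, kernel-checked 5-congruence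
(Fisher's indirect family `Y_A^(2)(5)`, member `(42 : 1)`, `u = 2788603774967808`), kernel data `card_c204624dp1_5` / `card_cm0p343_5` /
`hasCM_cm0p343` — is part L's and its imports', consumed BY NAME. NO `Surj`, NO `BSD(E,5)` input, NO descent, NO GRH, NO preprint, NO `hMT`.

References: [Kobayashi2003] Conj. (p. 2), Thm. 1.2, 4.1; [BDKim2009] Cor. 2.13, 2.5, Prop. 2.6; [PollackRubin2004] Thm. (p. 448);
[Pollack2003] Def. 6.15, Prop. 6.9/6.10/6.18; [Fisher2012Hessian] Thm. 13.2, §13; [Fisher2013QuinticTwists] Thm. 5.8; [GreenbergVatsal2000]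
Prop. (2.4); [Cremona2006] Table 1. Memo: `HOME/k3c4-MEMO-12.md`.
-/

set_option autoImplicit false
set_option linter.dupNamespace false
noncomputable section

open scoped Classical MatrixGroups ModularForm BigOperators

open CongruenceSubgroup WeierstrassCurve NumberField IsDedekindDomain Rat.HeightOneSpectrum
  Literature.NumberTheory.EllipticCurves
  Literature.NumberTheory.EllipticCurves.ModularForms
  Literature.NumberTheory.EllipticCurves.Rank1Residual
  Literature.NumberTheory.EllipticCurves.Rank1Residual.Typed
  Literature.NumberTheory.EllipticCurves.Kobayashi2003 ZpExtension
  Literature.NumberTheory.EllipticCurves.GreenbergVatsal2000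
  Literature.NumberTheory.EllipticCurves.BDKim2009
  Literature.NumberTheory.EllipticCurves.Fisher2012
  Literature.NumberTheory.EllipticCurves.Rank1Residual.X11RankOneCertificates
  Literature.NumberTheory.GaloisRepresentations
  Summit.BirchSwinnertonDyer.Rank1Residual.X1.MuLambda
  Summit.BirchSwinnertonDyer.Rank1Residual.Supersingular
  Summit.BirchSwinnertonDyer.Rank1Residual.X2.LocalDeltaCalculus
  Summit.BirchSwinnertonDyer.BirchSwinnertonDyer.Rank1Residual.IntModel
  Summit.BirchSwinnertonDyer.BirchSwinnertonDyer.Rank1Residual.X11RankOne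
  Summit.BirchSwinnertonDyer.Rank1Residual.X11b
  Summit.BirchSwinnertonDyer.Rank1Residual.X9
  Summit.BirchSwinnertonDyer.Rank1Residual.X1
  Summit.BirchSwinnertonDyer.BirchSwinnertonDyer.Theorems.CongruenceRoad

namespace Summit.BirchSwinnertonDyer.BirchSwinnertonDyer.Theorems.SmallImageCongruenceRoad

/-! ### Pair `204624dp1 @ 5` — the second sign `ε = −1` (odd layer `θ₃`) and both signs -/

/-- **`lam4_204624dp1_5_neg_one` — Kobayashi's main conjecture for `(204624dp1, 5, ε = −1)`**, the sign DROPPED by the gen-12 record `lam4_kobayashiMainConjecture_204624dp1_5` (part L, imported)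
because the pair's first odd layer is degenerate: `θ₁(E)` has `(μ, λ) = (1, 0)` (engine B of record, kit j275540: `θ₁(E)(0) = −40`; engine T:
`V = 4 = φ(5)`, undetermined) and `θ₁(A) ≡ 0`, so no odd-layer row below `θ₃` can be displayed. Same road, same binders (the L4LAM-r2 tuple EXACTLY),
same CM partner `A = cm0p343` = `[0, 0, 0, 0, 343]`, same kernel-checked 5-congruence (Fisher's indirect family, `(42 : 1)`, `u = 2788603774967808`, `hF'`)
and the same kernel δ-bookkeeping `places_204624dp1_5` (`Σδ_E = 0`, `Σδ_A = 1` over `Σ₀ = {2, 3, 7, 29}`), now fed with the ODD layer `n = n′ = 3`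
(Pollack's `θ₃`, `deg ω₃⁺ = φ(25) = 20`): E row `θ₃`: `(μ, λ) = (0, 20 + 6)`, A row `θ₃`: `(μ, λ) = (0, 20 + 5)` — bookkeeping `6 + 0 = 5 + 1`, and
`l′ = 5 = λ⁻(A)` of PARI's `ellpadiclambdamu(A, 5) = [[1, 5], [0, 0]]`. Rows DISPLAYED as hypotheses (kit j279021 + j279184, `--workitem …19002`,
evidence #43 / #44: engine B = the cell's msengine BYTE-IDENTICAL to j275540 at `JOB_NPOL = 5:4` — E `θ₃` `(0, 26)`, A `θ₃` `(0, 25)` — reproduced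
IDENTICALLY by EXACT modular symbols: eclib (Sage) on BOTH curves, PARI `msfromell` on `A`; memo `HOME/k3c4-MEMO-12.md`). PER PAIR; crux 4 stays OPEN; nothing booked; BSD is not proved by any of this.
[cite: Kobayashi2003, Conjecture (p. 2), Thm. 1.2 and Thm. 4.1] [cite: BDKim2009, Cor. 2.13, Cor. 2.5 and Prop. 2.6 (pp. 185–187)]
[cite: PollackRubin2004, Theorem (p. 448) = Thm. 7.3] [cite: Pollack2003, Def. 6.15, Prop. 6.9, 6.10 and 6.18]
[cite: Fisher2012Hessian, Thm. 13.2 and §13] [cite: GreenbergVatsal2000, §2 Prop. (2.4)] [cite: Cremona2006, Table 1 (Cremona label 204624dp1)] -/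
theorem lam4_kobayashiMainConjecture_204624dp1_5_neg_one
    (h12 : Kobayashi2003.thm12_signedSelmerDual_finite_torsion)
    (h41 : Kobayashi2003.thm41_signedCharIdeal_divisibility)
    (h5 : realPeriodRat_eq_unit_mul_plusPeriod) (h3 : realPeriodRat_eq_unit_mul_plusPeriod_three)
    (h09 : cor213_signedMu_eq_zero_iff_of_torsionIso)
    (hKim : BDKim2009.cor213_signedLambda_add_sum_delta_eq_of_torsionIso)
    (hPR : PollackRubin2004.mainTheorem_signedCharIdeal_eq_of_cm)
    (hmod : nonempty_modularParametrizationData)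
    (hF' : thm58_fiveCongruent_hessePencilInd)
    (W A : WeierstrassCurve ℚ) [W.IsElliptic] [W.IsGloballyMinimal] [A.IsElliptic] [A.IsGloballyMinimal]
    [Fact (Nat.Prime 5)] (hW : W = ⟨0, 0, 0, -16905, 1768851⟩) (hA : A = ⟨0, 0, 0, 0, 343⟩)
    (hPollack : ∀ {N : ℕ} [NeZero N] {f : CuspForm (Gamma0 N) 2},
      pollack_exists_plusMinusPAdicLFunction (W := A) (f := f) (p := 5))
    [NeZero (W.conductorNorm ℤ)] {f₀ : CuspForm (Gamma0 (W.conductorNorm ℤ)) 2} (hf₀ : IsNewformOf W f₀)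
    [NeZero (A.conductorNorm ℤ)] {f₀' : CuspForm (Gamma0 (A.conductorNorm ℤ)) 2} (hf₀' : IsNewformOf A f₀')
    {Θ Θ' : IwasawaAlgebra 5} (hΘ0 : Θ ≠ 0) (hμ : mu Θ = 0) (hΘ'0 : Θ' ≠ 0) (hμ' : mu Θ' = 0)
    (hΘ : iwasawaToPowerSeries 5 Θ = ((mazurTateElement f₀ 5 3).map (algebraMap ℚ ℚ_[5]) : PowerSeries ℚ_[5]))
    (hlam : lam Θ = (cyclotomicOmegaPlus 5 3).natDegree + 6)
    (hΘ' : iwasawaToPowerSeries 5 Θ' = ((mazurTateElement f₀' 5 3).map (algebraMap ℚ ℚ_[5]) : PowerSeries ℚ_[5]))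
    (hlam' : lam Θ' = (cyclotomicOmegaPlus 5 3).natDegree + 5) :
    KobayashiMainConjecture W 5 (-1) := by
  have hI : integralModelInt W = ⟨0, 0, 0, -16905, 1768851⟩ :=
    integralModelInt_eq_of_map_eq _ (by rw [hW]; ext <;> simp [WeierstrassCurve.map])
  have hI' : integralModelInt A = ⟨0, 0, 0, 0, 343⟩ :=
    integralModelInt_eq_of_map_eq _ (by rw [hA]; ext <;> simp [WeierstrassCurve.map])
  have hp2 : (5 : ℕ) ≠ 2 := by decide
  have hSS : GoodSS W 5 := goodSS_of_intModel 5 hI (by decide) Summit.BirchSwinnertonDyer.BirchSwinnertonDyer.Theorems.card_c204624dp1_5 (by norm_num)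
  have hap : W.frobeniusTrace 5 = 0 := by rw [frobeniusTrace_eq hI Summit.BirchSwinnertonDyer.BirchSwinnertonDyer.Theorems.card_c204624dp1_5]; norm_num
  have hSS' : GoodSS A 5 := goodSS_of_intModel 5 hI' (by decide) Summit.BirchSwinnertonDyer.BirchSwinnertonDyer.Theorems.card_cm0p343_5 (by norm_num)
  have hap' : A.frobeniusTrace 5 = 0 := by rw [frobeniusTrace_eq hI' Summit.BirchSwinnertonDyer.BirchSwinnertonDyer.Theorems.card_cm0p343_5]; norm_num
  have hcm' : A.HasCM := Summit.BirchSwinnertonDyer.BirchSwinnertonDyer.Theorems.hasCM_cm0p343 hI'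
  have hc4 : W.c₄ = (811440 : ℚ) := by
    subst hW; norm_num [WeierstrassCurve.c₄, WeierstrassCurve.b₂, WeierstrassCurve.b₄]
  have hc6 : W.c₆ = (-1528287264 : ℚ) := by
    subst hW; norm_num [WeierstrassCurve.c₆, WeierstrassCurve.b₂, WeierstrassCurve.b₄, WeierstrassCurve.b₆]
  have hc4A : A.c₄ = (0 : ℚ) := by
    subst hA; norm_num [WeierstrassCurve.c₄, WeierstrassCurve.b₂, WeierstrassCurve.b₄]
  have hc6A : A.c₆ = (-296352 : ℚ) := by
    subst hA; norm_num [WeierstrassCurve.c₆, WeierstrassCurve.b₂, WeierstrassCurve.b₄, WeierstrassCurve.b₆]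
  -- the 5-congruence `E[5] ≃ A[5]` as a THEOREM (Fisher's pencil of `A` through `E`), kernel-checked — the landed certificate verbatim
  have he := fiveCongruent_of_hesseIndCertificate hF' A W (42 : ℚ) (1 : ℚ) (2788603774967808 : ℚ)
    (by norm_num) (by rw [hc4A, hc6A, hc4, eval_hesseC4ind]; norm_num)
    (by rw [hc4A, hc6A, hc6, eval_hesseC6ind]; norm_num)
  obtain ⟨S₀, hS₀, hS₀W, hS₀A, hsumW, hsumA⟩ := places_204624dp1_5 W A hW hA
  exact kobayashiMainConjecture_neg_one_of_cmPartner_of_mazurTate h12 h41 h5 h3 h09 hKim hPR hmod hp2 hSS.1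
      hap hf₀ (by decide) hΘ hΘ0 hμ hlam hPollack hcm' hSS' hap' he hf₀' (by decide) hΘ' hΘ'0 hμ' hlam' S₀
      hS₀ hS₀W hS₀A (by rw [hsumW, hsumA])

/-- **Both signs AT THE PAIR `204624dp1 @ 5`**: `∀ ε, KobayashiMainConjecture W 5 ε` — Kobayashi's conjecture proper for this pair — from the
gen-12 record (`ε = 1`, even layer `θ₂` rows) and `lam4_kobayashiMainConjecture_204624dp1_5_neg_one` (`ε = −1`, odd layer `θ₃` rows); `ℤˣ = {1, −1}`.
PER PAIR; the crux is untouched; nothing booked. [cite: Kobayashi2003, Conjecture (p. 2) and Thm. 4.1] [cite: BDKim2009, Cor. 2.13 (p. 187)]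
[cite: Cremona2006, Table 1 (Cremona label 204624dp1)] -/
theorem lam4_forall_kobayashiMainConjecture_204624dp1_5
    (h12 : Kobayashi2003.thm12_signedSelmerDual_finite_torsion)
    (h41 : Kobayashi2003.thm41_signedCharIdeal_divisibility)
    (h5 : realPeriodRat_eq_unit_mul_plusPeriod) (h3 : realPeriodRat_eq_unit_mul_plusPeriod_three)
    (h09 : cor213_signedMu_eq_zero_iff_of_torsionIso)
    (hKim : BDKim2009.cor213_signedLambda_add_sum_delta_eq_of_torsionIso)
    (hPR : PollackRubin2004.mainTheorem_signedCharIdeal_eq_of_cm)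
    (hmod : nonempty_modularParametrizationData)
    (hF' : thm58_fiveCongruent_hessePencilInd)
    (W A : WeierstrassCurve ℚ) [W.IsElliptic] [W.IsGloballyMinimal] [A.IsElliptic] [A.IsGloballyMinimal]
    [Fact (Nat.Prime 5)] (hW : W = ⟨0, 0, 0, -16905, 1768851⟩) (hA : A = ⟨0, 0, 0, 0, 343⟩)
    (hPollack : ∀ {N : ℕ} [NeZero N] {f : CuspForm (Gamma0 N) 2},
      pollack_exists_plusMinusPAdicLFunction (W := A) (f := f) (p := 5))
    [NeZero (W.conductorNorm ℤ)] {f₀ : CuspForm (Gamma0 (W.conductorNorm ℤ)) 2} (hf₀ : IsNewformOf W f₀)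
    [NeZero (A.conductorNorm ℤ)] {f₀' : CuspForm (Gamma0 (A.conductorNorm ℤ)) 2} (hf₀' : IsNewformOf A f₀')
    {Θ₂ Θ₂' Θ₃ Θ₃' : IwasawaAlgebra 5}
    (hΘ₂ : iwasawaToPowerSeries 5 Θ₂ = ((mazurTateElement f₀ 5 2).map (algebraMap ℚ ℚ_[5]) : PowerSeries ℚ_[5]))
    (hΘ₂0 : Θ₂ ≠ 0) (hμ₂ : mu Θ₂ = 0) (hlam₂ : lam Θ₂ = (cyclotomicOmegaMinus 5 2).natDegree + 2)
    (hΘ₂' : iwasawaToPowerSeries 5 Θ₂' = ((mazurTateElement f₀' 5 2).map (algebraMap ℚ ℚ_[5]) : PowerSeries ℚ_[5]))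
    (hΘ₂'0 : Θ₂' ≠ 0) (hμ₂' : mu Θ₂' = 0) (hlam₂' : lam Θ₂' = (cyclotomicOmegaMinus 5 2).natDegree + 1)
    (hΘ₃ : iwasawaToPowerSeries 5 Θ₃ = ((mazurTateElement f₀ 5 3).map (algebraMap ℚ ℚ_[5]) : PowerSeries ℚ_[5]))
    (hΘ₃0 : Θ₃ ≠ 0) (hμ₃ : mu Θ₃ = 0) (hlam₃ : lam Θ₃ = (cyclotomicOmegaPlus 5 3).natDegree + 6)
    (hΘ₃' : iwasawaToPowerSeries 5 Θ₃' = ((mazurTateElement f₀' 5 3).map (algebraMap ℚ ℚ_[5]) : PowerSeries ℚ_[5]))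
    (hΘ₃'0 : Θ₃' ≠ 0) (hμ₃' : mu Θ₃' = 0) (hlam₃' : lam Θ₃' = (cyclotomicOmegaPlus 5 3).natDegree + 5) :
    ∀ ε : ℤˣ, KobayashiMainConjecture W 5 ε := by
  intro ε
  rcases Int.units_eq_one_or ε with rfl | rfl
  · exact lam4_kobayashiMainConjecture_204624dp1_5 h12 h41 h5 h3 h09 hKim hPR hmod hF' W A hW hA hPollack hf₀ hf₀'
      (1) hΘ₂0 hμ₂ hΘ₂'0 hμ₂' (⟨rfl, hΘ₂, hlam₂, hΘ₂', hlam₂'⟩)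
  · exact lam4_kobayashiMainConjecture_204624dp1_5_neg_one h12 h41 h5 h3 h09 hKim hPR hmod hF' W A hW hA hPollack hf₀ hf₀'
      hΘ₃0 hμ₃ hΘ₃'0 hμ₃' hΘ₃ hlam₃ hΘ₃' hlam₃'

end Summit.BirchSwinnertonDyer.BirchSwinnertonDyer.Theorems.SmallImageCongruenceRoad

end
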